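import Summits.BirchSwinnertonDyer.BirchSwinnertonDyer.Theorems.AdditiveBranchIMCGordTwoRankZeroExact
import Summits.BirchSwinnertonDyer.Rank1Residual.Additive.GordChiBranchKatoComponent
import Summits.BirchSwinnertonDyer.Rank1Residual.Additive.GordRankZeroKatoComponentTower
import Summits.BirchSwinnertonDyer.Rank1Residual.Additive.SemistableTwistAnalyticOdd
import HarnessLib

/-!
# Crux `GordTwoRankZeroOffCaseOne` (item 19357): the rank-0 Λ-adic upgrade on the ODD branch
# (`p ≡ 3 (mod 4)`, `p = 3` included) — twin of `AdditiveBranchIMCGordTwoRankZeroLambdaAdic`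

Cell `bsd-addord`, seat `bsd-addord-k1-c2` (D-0074 row B1). HONEST FRAMING: nothing here proves the
Birch–Swinnerton-Dyer conjecture, the crux, or any main conjecture; every published input is an explicit
named-fact binder — Kato 2004 Thm. 17.4 (3) read on the `ω^{(p−1)/2}`-component (`hK`, READING fact
`Kato2004.charIdeal_dvd_padicLFunctionBranch_component_of_surjective`), modularity (`hmod`); the odd
Birch–Pal identity `L(E,1) = ±ϖ⁻·∑(a/p)[a/p]⁻_{f♭}·Ω_E/(|u| c_∞)` is a tree THEOREM
(`entireLFunction_one_eq_of_twist_neg`, Pal for `d = −p < 0` proved); the main-conjecture LOWER input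
stays DISPLAYED.

On the irreducible rows of cell (G-ord, `e = 2`) with `ρ_{E,p^∞}` tower-surjective and `p ≡ 3 (mod 4)`
(minus symbols, twist by `p* = −p`), in analytic rank `0`: the `T = 0` lower input
`ChiBranchLowerLeadingTermOddAt W p` — by the Exact file the same thing as the crux's conclusion
`MissingLowerBoundAt W p` there — together with Kato's Λ-adic divisibility forces the FULL main conjecture
on the branch, `char_Λ X(E/ℚ_∞) = (g_K)`, `ι g_K = u·ϖ⁻·L_p⁻(f♭, α, ω^{(p−1)/2}, T)`, `u ∈ ℤ_p^×`; in
particular the conclusion of the Λ-adic lower input `ChiBranchLowerDivisibilityOddAt` holds at every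
such datum. Same elementary mechanism as the even file (`h(0)·c = u·α⁻¹ ∈ ℤ_p^×`, `ϖ⁻ S⁻ ≠ 0` from
`L(E,1) ≠ 0`).

* §1 `exists_mem_charIdeal_eq_unit_mul_minusBranch_of_katoComponent` — Kato's element Λ-adically, odd
  branch, big image (the tree's `chiBranchLeadingTermOddBigImageAt_of_katoComponent`, conclusion kept Λ-adic).
* §2 `charIdeal_eq_span_kato_of_chiBranchLowerLeadingTermOdd_rankZero` (per datum: full branch IMC from
  the `T = 0` input), §3 `chiBranchLowerDivisibilityOdd_of_chiBranchLowerLeadingTermOdd_rankZero_towerSurj`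
  and `charIdeal_eq_span_kato_of_missingLowerBoundAt_rankZero_odd` (from the crux's own conclusion).

References: K. Kato, Astérisque 295 (2004) Thm. 17.4 (3) [Kato2004Asterisque]; B. Mazur, J. Tate,
J. Teitelbaum, Invent. Math. 84 (1986) §I.13–I.14 [MazurTateTeitelbaum1986Invent]; V. Pal, Proc. AMS 140
(2012) Thm. 3.2 [Pal2012]; D. Delbourgo, Compositio Math. 113 (1998) Prop. 4 [Delbourgo1998];
L. C. Washington, Introduction to Cyclotomic Fields, §13.2 [Washington1997].
-/

set_option autoImplicit false
set_option linter.dupNamespace false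

noncomputable section

open scoped Classical MatrixGroups ModularForm

open CongruenceSubgroup WeierstrassCurve NumberField IsDedekindDomain Rat.HeightOneSpectrum
  Literature.NumberTheory.EllipticCurves
  Literature.NumberTheory.EllipticCurves.ModularForms
  Literature.NumberTheory.EllipticCurves.Rank1Residual
  Literature.NumberTheory.EllipticCurves.Rank1Residual.Typed
  Literature.NumberTheory.GaloisRepresentations

namespace Summit.BirchSwinnertonDyer.BirchSwinnertonDyer.Theorems.AdditiveBranchIMCGordTwoRankZeroLambdaAdicOdd

open Summit.BirchSwinnertonDyer.Rank1Residual.Additive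
open Summit.BirchSwinnertonDyer.BirchSwinnertonDyer.Theses.AdditiveBranchIMC
open Summit.BirchSwinnertonDyer.BirchSwinnertonDyer.Theorems.AdditiveBranchIMCGordTwoRankZeroTransport
open Summit.BirchSwinnertonDyer.BirchSwinnertonDyer.Theorems.AdditiveBranchIMCGordTwoRankZeroExact

variable {W : WeierstrassCurve ℚ} [W.IsElliptic] {p : ℕ} [hp : Fact p.Prime]

/-! ## §1 Kato's element on the odd branch, Λ-adically (big image) -/

/-- **Kato 2004 Thm. 17.4 (3) on the `ω^{(p−1)/2}`-component, Λ-ADIC form, ODD branch (`p ≡ 3 (mod 4)`),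
big image.** For `W/ℚ` potentially good at `p` (`0 ≤ ord_p j(W)`), `ℚ`-isomorphic to the twist by `−p`
of a globally minimal `V` good ordinary or multiplicative at `p` with `ρ_{V,pⁿ}` onto for every `n`,
newform `f`, `ϖ⁻·|Ω⁻(V)| = Ω⁻_f`, cyclotomic `κ/γ` and a dual datum `D` of `Sel_{p^∞}(W/ℚ_∞)`: SOME
`g ∈ char_Λ X(W/ℚ_∞)` has `ι g = u·ϖ⁻·L_p⁻(f, α, ω^{(p−1)/2}, T)` with `u ∈ ℤ_p^×`. Same chain as the
tree's `chiBranchLeadingTermOddBigImageAt_of_katoComponent`, conclusion kept Λ-adic.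
[cite: Kato2004Asterisque, Thm. 17.4 (3) (p. 273)] [cite: GreenbergLNM1716, §5 p. 143] -/
theorem exists_mem_charIdeal_eq_unit_mul_minusBranch_of_katoComponent
    (hK : Kato2004.charIdeal_dvd_padicLFunctionBranch_component_of_surjective)
    (hj : 0 ≤ padicValRat p W.j)
    (V : WeierstrassCurve ℚ) [V.IsElliptic] [V.IsGloballyMinimal]
    {κ : ZpExtension ℚ p} {γ : Field.absoluteGaloisGroup ℚ} {N : ℕ} [NeZero N]
    {f : CuspForm (Gamma0 N) 2} (hp3 : p % 4 = 3)
    (hCW : ∃ C : VariableChange ℚ, C • V.quadraticTwist (-(p : ℚ)) = W) (hVgm : GoodOrd V p ∨ Mult V p)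
    (hsurj : ∀ n : ℕ, V.HasSurjectiveModNGaloisRep (p ^ n : ℕ))
    (hκ : κ.IsCyclotomic) (hγ : κ.IsTopGenerator γ) (hcv : IsCyclotomicVariable p γ)
    (hf : IsNewformOf V f) (D : W.SelmerDualData κ γ) (ϖ : ℚ)
    (hϖ : (ϖ : ℝ) * V.imaginaryPeriodRat = minusPeriod f) :
    ∃ g ∈ D.charIdeal, ∃ u : ℤ_[p]ˣ,
      iwasawaToPowerSeries p g =
        PowerSeries.C (((u : ℤ_[p]) : ℚ_[p]) * (ϖ : ℚ_[p])) *
          padicLFunctionMinusBranch f ((unitRoot V p : ℤ_[p]) : ℚ_[p]) (p / 2) := by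
  have hp2 : p ≠ 2 := by rintro rfl; norm_num at hp3
  have hpne : (-(p : ℚ)) ≠ 0 := neg_ne_zero.mpr (Nat.cast_ne_zero.mpr hp.out.ne_zero)
  have hodd : ¬ Even (p / 2) := by rw [Nat.not_even_iff_odd]; exact ⟨p / 4, by omega⟩
  have hord : IsOrdinaryAt V p := isOrdinaryAt_of_goodOrd_or_mult_of_model_twist W V hpne hCW hj hVgm
  obtain ⟨C, hC⟩ := hCW
  haveI hcycL : IsCyclotomicExtension {p} ℚ (CyclotomicField p ℚ) := by
    have h : (CyclotomicField.algebra p ℚ : Algebra ℚ (CyclotomicField p ℚ)) =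
        DivisionRing.toRatAlgebra := Subsingleton.elim _ _
    exact h ▸ CyclotomicField.isCyclotomicExtension p ℚ
  obtain ⟨K, θ, hK2, hθ, hθ2⟩ := exists_intermediateField_sq_eq_pStar p (CyclotomicField p ℚ) hp2
  haveI : NumberField K := NumberField.of_module_finite ℚ K
  have hcK : θ ^ 2 = algebraMap ℚ K (-(p : ℚ)) := by
    rw [hθ2, pStar_eq_neg_of_mod_four_eq_three hp3]
  haveI : IsGalois ℚ K := isGalois_of_finrank_eq_two K hK2
  haveI := normal_galRange K hK2 (sigmaQ_ne_one K hK2 hθ hcK)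
  haveI := normal_galRange_cyclotomic p (CyclotomicField p ℚ)
  haveI : (V.quadraticTwist (-(p : ℚ))).IsElliptic := V.isElliptic_quadraticTwist hpne
  obtain ⟨γ', hγ'KF, hκγ', ⟨g₀, hg₀, hγ'eq⟩, D', hchar, htor⟩ :=
    SelmerDualData.exists_chiEigenInCyclotomic p (CyclotomicField p ℚ) V K hK2 hθ hcK κ hC hp2 D
  obtain ⟨-, g, hgmem, u, hιg⟩ := hK p V K (CyclotomicField p ℚ) (κ := κ) (γ := γ') (f := f)
    (chiEigenSelmerIn V K p κ (galRange (K := ℚ) (CyclotomicField p ℚ)))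
    (fun t ht ↦ conjH1_mem_chiEigenSelmerIn γ' ht) D'.X D'.toDual hp2 hK2 ⟨θ, hθ2⟩ hord hsurj hκ
    (isTopGenerator_of_kappa_eq κ hκγ' hγ)
    (isCyclotomicVariable_of_eq_mul p κ hκ hg₀ hγ'eq hcv)
    (Subgroup.mem_inf.mp hγ'KF).1 (Subgroup.mem_inf.mp hγ'KF).2 hf
    (mem_chiEigenSelmerIn_iff_ite V K κ _) D'.bijective D'.toDual_T_smul D'.toDual_C_smul ϖ
    (by rw [if_neg hodd]; exact hϖ)
  rw [if_neg hodd] at hιg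
  exact ⟨g, hchar ▸ hgmem, u, hιg⟩

/-! ## §2 Rank `0`, odd branch: the `T = 0` lower input + Kato ⟹ the full branch main conjecture -/

/-- **The full main conjecture on the `ω^{(p−1)/2}`-branch from the `T = 0` lower input, analytic rank
`0`, ODD branch** (per datum). `W = E` globally minimal, additive of type (G)-ordinary at
`p ≡ 3 (mod 4)` (`p = 3` included), `ord_{s=1} L(E,s) = 0`, `ρ_{E,pⁿ}` onto for all `n`; `(V, f, ϖ⁻)` a
good ordinary twist datum (`C • V^{(−p)} = W`, `ϖ⁻·|Ω⁻(V)| = Ω⁻_f`), `D` a dual datum at a cyclotomic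
`κ/γ`. IF `ChiBranchLowerLeadingTermOddAt W p` holds, then `char_Λ X(E/ℚ_∞) = (g_K)` with
`ι g_K = u·ϖ⁻·L_p⁻(f, α, ω^{(p−1)/2}, T)`, `u ∈ ℤ_p^×`. Inputs by name: Kato `hK`, modularity `hmod`
(odd Birch: `L(E,1) = ±ϖ⁻ S⁻ Ω_E/(|u| c_∞)`, so `ϖ⁻ S⁻ ≠ 0` in rank `0`), `α ∈ ℤ_p^×`, principality.
[cite: Kato2004Asterisque, Thm. 17.4 (3) (p. 273)] [cite: MazurTateTeitelbaum1986Invent, §I.14]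
[cite: Pal2012, Thm. 3.2] [cite: Washington1997, §13.2] -/
theorem charIdeal_eq_span_kato_of_chiBranchLowerLeadingTermOdd_rankZero [W.IsGloballyMinimal]
    (hK : Kato2004.charIdeal_dvd_padicLFunctionBranch_component_of_surjective)
    (hmod : hasEntireLFunction_rat)
    (hadd : Addv W p) (hG : TypeGOrd W p) (hr : W.analyticRank = 0)
    (htower : ∀ n : ℕ, W.HasSurjectiveModNGaloisRep (p ^ n : ℕ))
    (hLow : ChiBranchLowerLeadingTermOddAt W p)
    (V : WeierstrassCurve ℚ) [V.IsElliptic] [V.IsGloballyMinimal]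
    {κ : ZpExtension ℚ p} {γ : Field.absoluteGaloisGroup ℚ} {N : ℕ} [NeZero N]
    {f : CuspForm (Gamma0 N) 2} (hp3 : p % 4 = 3)
    (hCW : ∃ C : VariableChange ℚ, C • V.quadraticTwist (-(p : ℚ)) = W) (hV : GoodOrd V p)
    (hκ : κ.IsCyclotomic) (hγ : κ.IsTopGenerator γ) (hcv : IsCyclotomicVariable p γ)
    (hf : IsNewformOf V f) (D : W.SelmerDualData κ γ) (ϖ : ℚ)
    (hϖ : (ϖ : ℝ) * V.imaginaryPeriodRat = minusPeriod f) :
    ∃ gK ∈ D.charIdeal, ∃ u : ℤ_[p]ˣ, D.charIdeal = Ideal.span {gK} ∧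
      iwasawaToPowerSeries p gK =
        PowerSeries.C (((u : ℤ_[p]) : ℚ_[p]) * (ϖ : ℚ_[p])) *
          padicLFunctionMinusBranch f ((unitRoot V p : ℤ_[p]) : ℚ_[p]) (p / 2) := by
  have hp2 : p ≠ 2 := by rintro rfl; norm_num at hp3
  have hpne : (-(p : ℚ)) ≠ 0 := neg_ne_zero.mpr (Nat.cast_ne_zero.mpr hp.out.ne_zero)
  have hj : 0 ≤ padicValRat p W.j := padicValRat_j_nonneg_of_typeGOrd W p hG
  -- the tower of `E` is the tower of `V`
  have hsurjV : ∀ n : ℕ, V.HasSurjectiveModNGaloisRep (p ^ n : ℕ) := fun n ↦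
    (Summit.BirchSwinnertonDyer.Rank1Residual.GaloisImage.hasSurjectiveModNGaloisRep_pow_iff_of_model_twist
      V p hpne hCW n).mp (htower n)
  -- Kato's element, Λ-adically
  obtain ⟨gK, hgK, u, hιgK⟩ := exists_mem_charIdeal_eq_unit_mul_minusBranch_of_katoComponent hK hj V hp3
    hCW (Or.inl hV) hsurjV hκ hγ hcv hf D ϖ hϖ
  -- a generator `f₁` of `char X`
  haveI : (Module.charIdeal (IwasawaAlgebra p) D.X).IsPrincipal := charIdeal_isPrincipal_holds p D.X
  obtain ⟨f₁, hf₁⟩ := Submodule.IsPrincipal.principal (Module.charIdeal (IwasawaAlgebra p) D.X)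
  have hf₁mem : f₁ ∈ D.charIdeal := by
    change f₁ ∈ Module.charIdeal (IwasawaAlgebra p) D.X
    rw [hf₁]
    exact Ideal.mem_span_singleton_self f₁
  -- the `T = 0` lower input at `f₁`: `f₁(0) = c·ϖ⁻·S⁻`
  obtain ⟨c, hc⟩ := hLow V hp3 hCW (Or.inl hV) hκ hγ hcv hf D ϖ hϖ f₁ hf₁mem
  -- `gK = h · f₁`
  have hgK' : gK ∈ Ideal.span {f₁} := by
    change gK ∈ Module.charIdeal (IwasawaAlgebra p) D.X at hgK
    rwa [hf₁] at hgK
  obtain ⟨h, hh⟩ := Ideal.mem_span_singleton'.mp hgK'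
  -- constant terms
  have hord : IsOrdinaryAt V p := hV
  obtain ⟨-, hunit⟩ := unitRoot_spec_holds V p hord
  obtain ⟨ua, hua⟩ := hunit
  have h0 := congrArg PowerSeries.constantCoeff hιgK
  rw [constantCoeff_iwasawaToPowerSeries, map_mul, PowerSeries.constantCoeff_C,
    constantCoeff_padicLFunctionMinusBranch_half p hp2 V hord hf] at h0
  have hprod : ((PowerSeries.constantCoeff gK : ℤ_[p]) : ℚ_[p]) =
      ((PowerSeries.constantCoeff h : ℤ_[p]) : ℚ_[p]) *
        ((PowerSeries.constantCoeff f₁ : ℤ_[p]) : ℚ_[p]) := by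
    rw [← hh, map_mul, PadicInt.coe_mul]
  -- `ϖ⁻ S⁻ ≠ 0` in rank `0` (odd Birch + Pal for `d = −p`)
  have hϖS : (ϖ : ℚ_[p]) * (legendreMinusSymbolSum f p : ℚ_[p]) ≠ 0 := by
    obtain ⟨C, hC⟩ := hCW
    obtain ⟨ε, -, hL⟩ := entireLFunction_one_eq_of_twist_neg p hmod hp3 V W C hC hadd hf ϖ hϖ
    have hL0 : W.entireLFunction 1 ≠ 0 := (W.analyticRank_eq_zero_iff_holds (hmod W)).mp hr
    have hq : (ϖ * legendreMinusSymbolSum f p : ℚ) ≠ 0 := by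
      intro hz
      apply hL0
      rw [hL, hz, mul_zero, zero_div, Rat.cast_zero, zero_mul]
    have hq' : ((ϖ * legendreMinusSymbolSum f p : ℚ) : ℚ_[p]) ≠ 0 := by exact_mod_cast hq
    simpa [Rat.cast_mul] using hq'
  -- hence `h(0)·c = u·α⁻¹`, a unit of `ℤ_p`
  have hkey : ((PowerSeries.constantCoeff h : ℤ_[p]) : ℚ_[p]) * (c : ℚ_[p]) =
      ((u : ℤ_[p]) : ℚ_[p]) * (((ua : ℤ_[p]) : ℚ_[p]))⁻¹ := by
    have e1 : ((PowerSeries.constantCoeff h : ℤ_[p]) : ℚ_[p]) * (c : ℚ_[p]) *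
        ((ϖ : ℚ_[p]) * (legendreMinusSymbolSum f p : ℚ_[p])) =
        ((u : ℤ_[p]) : ℚ_[p]) * (((ua : ℤ_[p]) : ℚ_[p]))⁻¹ *
          ((ϖ : ℚ_[p]) * (legendreMinusSymbolSum f p : ℚ_[p])) := by
      have e2 := h0
      rw [hprod, hc, ← hua] at e2
      linear_combination e2
    exact mul_right_cancel₀ hϖS e1
  have hunitZ : IsUnit (PowerSeries.constantCoeff h * c) := by
    have hcoe : (((PowerSeries.constantCoeff h * c : ℤ_[p])) : ℚ_[p]) =
        (((u * ua⁻¹ : ℤ_[p]ˣ) : ℤ_[p]) : ℚ_[p]) := by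
      rw [PadicInt.coe_mul, hkey, Units.val_mul, PadicInt.coe_mul, coe_units_inv_eq_inv]
    have heq : PowerSeries.constantCoeff h * c = ((u * ua⁻¹ : ℤ_[p]ˣ) : ℤ_[p]) :=
      PadicInt.ext hcoe
    rw [heq]
    exact Units.isUnit _
  have hunit_h : IsUnit h :=
    (PowerSeries.isUnit_iff_constantCoeff (φ := h)).mpr (isUnit_of_mul_isUnit_left hunitZ)
  -- so `(f₁) = (gK)`
  have hspan : Ideal.span {f₁} = Ideal.span ({gK} : Set (IwasawaAlgebra p)) := by
    rw [← hh]
    exact (Ideal.span_singleton_mul_left_unit hunit_h f₁).symm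
  refine ⟨gK, hgK, u, ?_, hιgK⟩
  change Module.charIdeal (IwasawaAlgebra p) D.X = _
  rw [hf₁]
  exact hspan

/-! ## §3 Consequences on the odd branch -/

/-- **The Λ-adic ODD lower input holds for every tower-surjective good ordinary twist datum, given the
`T = 0` odd input in rank `0`** (`p ≡ 3 (mod 4)`): for every `g ∈ char_Λ X(E/ℚ_∞)`,
`ι g = ι h · (ϖ⁻·L_p⁻(f, α, ω^{(p−1)/2}, T))` for some `h ∈ Λ` — the conclusion of
`ChiBranchLowerDivisibilityOddAt W p` at that datum. [cite: Kato2004Asterisque, Thm. 17.4 (3) (p. 273)]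
[cite: MazurTateTeitelbaum1986Invent, §I.14] -/
theorem chiBranchLowerDivisibilityOdd_of_chiBranchLowerLeadingTermOdd_rankZero_towerSurj
    [W.IsGloballyMinimal]
    (hK : Kato2004.charIdeal_dvd_padicLFunctionBranch_component_of_surjective)
    (hmod : hasEntireLFunction_rat)
    (hadd : Addv W p) (hG : TypeGOrd W p) (hr : W.analyticRank = 0)
    (htower : ∀ n : ℕ, W.HasSurjectiveModNGaloisRep (p ^ n : ℕ))
    (hLow : ChiBranchLowerLeadingTermOddAt W p)
    (V : WeierstrassCurve ℚ) [V.IsElliptic] [V.IsGloballyMinimal]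
    {κ : ZpExtension ℚ p} {γ : Field.absoluteGaloisGroup ℚ} {N : ℕ} [NeZero N]
    {f : CuspForm (Gamma0 N) 2} (hp3 : p % 4 = 3)
    (hCW : ∃ C : VariableChange ℚ, C • V.quadraticTwist (-(p : ℚ)) = W) (hV : GoodOrd V p)
    (hκ : κ.IsCyclotomic) (hγ : κ.IsTopGenerator γ) (hcv : IsCyclotomicVariable p γ)
    (hf : IsNewformOf V f) (D : W.SelmerDualData κ γ) (ϖ : ℚ)
    (hϖ : (ϖ : ℝ) * V.imaginaryPeriodRat = minusPeriod f) :
    ∀ g ∈ D.charIdeal, ∃ h : IwasawaAlgebra p,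
      iwasawaToPowerSeries p g =
        iwasawaToPowerSeries p h *
          (PowerSeries.C ((ϖ : ℚ) : ℚ_[p]) *
            padicLFunctionMinusBranch f (unitRoot V p : ℚ_[p]) (p / 2)) := by
  obtain ⟨gK, -, u, hchar, hιgK⟩ := charIdeal_eq_span_kato_of_chiBranchLowerLeadingTermOdd_rankZero hK
    hmod hadd hG hr htower hLow V hp3 hCW hV hκ hγ hcv hf D ϖ hϖ
  intro g hg
  rw [hchar] at hg
  obtain ⟨k, hk⟩ := Ideal.mem_span_singleton'.mp hg
  refine ⟨k * PowerSeries.C (u : ℤ_[p]), ?_⟩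
  have hC : iwasawaToPowerSeries p (PowerSeries.C (u : ℤ_[p])) =
      PowerSeries.C (((u : ℤ_[p]) : ℤ_[p]) : ℚ_[p]) := by
    rw [iwasawaToPowerSeries, PowerSeries.map_C]
    rfl
  rw [← hk]
  simp only [map_mul, hιgK, hC]
  ring

/-- **From the crux's own conclusion, odd branch.** On a tower-surjective pair of cell (G-ord, `e = 2`)
with `p ≡ 3 (mod 4)` and `r_an = 0`, the lower half `MissingLowerBoundAt W p` gives the full branch main
conjecture for every good ordinary twist datum — through the Exact file
(`missingLowerBoundAt_iff_chiBranchLowerLeadingTermOddAt_cellGordTwo`: `hDel`, `hDelG`, GZK, modularity,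
`hmodD`) and §2 (Kato `hK`). [cite: Kato2004Asterisque, Thm. 17.4 (3) (p. 273)]
[cite: Delbourgo1998, Prop. 4 (p. 144)] [cite: Miller2011LMS, Def. 1.1] -/
theorem charIdeal_eq_span_kato_of_missingLowerBoundAt_rankZero_odd [W.IsGloballyMinimal]
    (hK : Kato2004.charIdeal_dvd_padicLFunctionBranch_component_of_surjective)
    (hDel : Delbourgo1998.prop4_rankZero_pow_dvd_constantCoeff)
    (hDelG : Delbourgo1998.prop4_rankZero_constantCoeff_eq_unit_mul_of_potGoodOrd)
    (hGZK : rank_eq_analyticRank_of_analyticRank_le_one) (hmod : hasEntireLFunction_rat)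
    (hmodD : nonempty_modularParametrizationData)
    (hc : N10.CellGordTwo W p) (hp3 : p % 4 = 3) (hr : W.analyticRank = 0)
    (htower : ∀ n : ℕ, W.HasSurjectiveModNGaloisRep (p ^ n : ℕ))
    (hlow : MissingLowerBoundAt W p)
    (V : WeierstrassCurve ℚ) [V.IsElliptic] [V.IsGloballyMinimal]
    {κ : ZpExtension ℚ p} {γ : Field.absoluteGaloisGroup ℚ} {N : ℕ} [NeZero N]
    {f : CuspForm (Gamma0 N) 2}
    (hCW : ∃ C : VariableChange ℚ, C • V.quadraticTwist (-(p : ℚ)) = W) (hV : GoodOrd V p)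
    (hκ : κ.IsCyclotomic) (hγ : κ.IsTopGenerator γ) (hcv : IsCyclotomicVariable p γ)
    (hf : IsNewformOf V f) (D : W.SelmerDualData κ γ) (ϖ : ℚ)
    (hϖ : (ϖ : ℝ) * V.imaginaryPeriodRat = minusPeriod f) :
    ∃ gK ∈ D.charIdeal, ∃ u : ℤ_[p]ˣ, D.charIdeal = Ideal.span {gK} ∧
      iwasawaToPowerSeries p gK =
        PowerSeries.C (((u : ℤ_[p]) : ℚ_[p]) * (ϖ : ℚ_[p])) *
          padicLFunctionMinusBranch f ((unitRoot V p : ℤ_[p]) : ℚ_[p]) (p / 2) :=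
  charIdeal_eq_span_kato_of_chiBranchLowerLeadingTermOdd_rankZero hK hmod hc.2.1 hc.2.2.1 hr htower
    ((missingLowerBoundAt_iff_chiBranchLowerLeadingTermOddAt_cellGordTwo hDel hDelG hGZK hmod hmodD hc hp3
      hr).mp hlow) V hp3 hCW hV hκ hγ hcv hf D ϖ hϖ

end Summit.BirchSwinnertonDyer.BirchSwinnertonDyer.Theorems.AdditiveBranchIMCGordTwoRankZeroLambdaAdicOdd

end
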